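import Literature.Analysis.SpecialFunctions.BesselKLaplace
import Literature.Analysis.Convolution.LaplaceTransformConvolution
import HarnessLib

/-!
# The Bessel–Laplace kernel measures: `t^{-p} ∫ e^{νu - c t cosh u} du` as a shifted Laplace transform

Topic `Literature/Analysis/SpecialFunctions`, continuing `BesselKLaplace`
(`exists_measure_laplace_eq_integral_exp_cosh`: `∫ e^{νu - c t cosh u} du` is the Laplace transform
of the push-forward of `e^{νu} du` under `u ↦ c cosh u`) and
`Literature/Analysis/Convolution/LaplaceTransformConvolution`
(`exists_finiteMeasure_rpow_neg_mul_laplace`: power prefactors are absorbed by convolution with a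
Gamma density). Here the measures are given NAMES, so that later files can compare them near the
endpoint `c` of their support:

* `coshMeasure ν c` — the push-forward of `e^{νu} du` under `u ↦ c cosh u`; carried by `[c, ∞)`,
  charging every interval there, `∫ e^{-lt} d(coshMeasure ν c)(l) = ∫ e^{νu - c t cosh u} du` and
  `l ↦ e^{-lt}` is integrable for every `t > 0` (NOT a finite measure, but `e^{-l t₀} · coshMeasure`
  is, `isFiniteMeasure_withDensity_coshMeasure`);
* `gammaMeasure p t₀` — the finite measure `e^{-l t₀} l^{p-1} / Γ(p) dl` on `(0, ∞)`, with
  `∫ e^{-l(t - t₀)} d(gammaMeasure p t₀) = t^{-p}` for `t > t₀` (in fact for all `t > 0`,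
  `laplace_gammaMeasure_of_pos`);
* `besselLaplaceMeasure ν p c t₀ = (e^{-l t₀} · coshMeasure ν c) ∗ gammaMeasure p t₀` — a FINITE
  measure carried by `[c, ∞)`, charging every `(α, β)` with `c ≤ α < β`, with
  **`t^{-p} ∫ e^{νu - c t cosh u} du = ∫ e^{-l (t - t₀)} d(besselLaplaceMeasure ν p c t₀)(l)`**
  for all `t > t₀` (`laplace_besselLaplaceMeasure`; in fact for all `t > 0`,
  `laplace_besselLaplaceMeasure_of_pos`), whence its total mass
  `t₀^{-p} ∫ e^{νu - c t₀ cosh u} du` (`besselLaplaceMeasure_real_univ`).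

Finally `integral_exp_sub_mul_cosh_le_exp_mul` records the exponential decay of
`∫ e^{νu - c t cosh u} du` in `c` (`cosh ≥ 1`).

With `c = 2π‖w‖` these are the depth profiles of the in-plane Fourier modes of lattice sums of the
kernels `(‖x‖² + t²)^{-s}` (Watson §6.22–6.23; Feller XIII.2). [cite: Watson1944, §6.22 (5)]

All proofs are repackagings of the two files above (`integral_map` /
`integral_withDensity_eq_integral_toReal_smul` for `coshMeasure`, the Gamma integral
`rpow_neg_eq_integral_exp_neg_mul` for `gammaMeasure`, and the product theorem
`integral_exp_neg_mul_conv` with `conv_apply_Iio_eq_zero` / `conv_apply_Ioo_pos` for the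
convolution). Hypotheses that a statement does not need but that are kept for a uniform API are
spelled with a leading underscore.
-/

noncomputable section

namespace Literature.Analysis.SpecialFunctions

open _root_.MeasureTheory Set Filter
open Literature.Analysis.Convolution
open scoped ENNReal

/-- The push-forward of `e^{νu} du` under `u ↦ c cosh u`. [folklore] -/
def coshMeasure (ν c : ℝ) : Measure ℝ :=
  Measure.map (fun u : ℝ => c * Real.cosh u)
    ((volume : Measure ℝ).withDensity fun u => ENNReal.ofReal (Real.exp (ν * u)))

/-- The finite measure `e^{-l t₀} l^{p-1} / Γ(p) dl` on `(0, ∞)`. [folklore] -/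
def gammaMeasure (p t₀ : ℝ) : Measure ℝ :=
  ((volume : Measure ℝ).restrict (Ioi 0)).withDensity
    fun l => ENNReal.ofReal (Real.exp (-(l * t₀)) * (l ^ (p - 1) / Real.Gamma p))

/-- The Bessel–Laplace kernel measure `(e^{-l t₀} · coshMeasure ν c) ∗ gammaMeasure p t₀`. [folklore] -/
def besselLaplaceMeasure (ν p c t₀ : ℝ) : Measure ℝ :=
  ((coshMeasure ν c).withDensity fun l => ENNReal.ofReal (Real.exp (-(l * t₀)))) ∗ gammaMeasure p t₀

/-! ## s-finiteness instances -/

/-- `coshMeasure ν c` is s-finite (a push-forward of a density with respect to Lebesgue measure);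
this makes Mathlib's convolution API (`Measure.lintegral_conv`, `integral_exp_neg_mul_conv`, …)
available. [folklore] -/
instance sFinite_coshMeasure (ν c : ℝ) : SFinite (coshMeasure ν c) := by
  unfold coshMeasure; infer_instance

/-- `gammaMeasure p t₀` is s-finite (a density with respect to a restriction of Lebesgue
measure). [folklore] -/
instance sFinite_gammaMeasure (p t₀ : ℝ) : SFinite (gammaMeasure p t₀) := by
  unfold gammaMeasure; infer_instance

/-- `besselLaplaceMeasure ν p c t₀` is s-finite (a convolution of s-finite measures). [folklore] -/
instance sFinite_besselLaplaceMeasure (ν p c t₀ : ℝ) : SFinite (besselLaplaceMeasure ν p c t₀) := by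
  unfold besselLaplaceMeasure; infer_instance

/-! ## `coshMeasure` -/

/-- The map `u ↦ c cosh u` is measurable. [folklore] -/
theorem measurable_const_mul_cosh (c : ℝ) : Measurable fun u : ℝ => c * Real.cosh u :=
  (continuous_const.mul Real.continuous_cosh).measurable

/-- The density `u ↦ e^{νu}` (valued in `ℝ≥0∞`) is measurable. [folklore] -/
theorem measurable_ofReal_exp_mul (ν : ℝ) :
    Measurable fun u : ℝ => ENNReal.ofReal (Real.exp (ν * u)) :=
  (Real.continuous_exp.comp (continuous_const.mul continuous_id)).measurable.ennreal_ofReal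

/-- `l ↦ e^{-lt}` is continuous. [folklore] -/
theorem continuous_exp_neg_mul (t : ℝ) : Continuous fun l : ℝ => Real.exp (-(l * t)) :=
  Real.continuous_exp.comp (continuous_id.mul continuous_const).neg

/-- The pulled-back Laplace integrand of `coshMeasure`:
`e^{νu} · e^{-(c cosh u) t} = e^{νu - c t cosh u}`. [folklore] -/
theorem toReal_ofReal_exp_smul_exp_neg (ν c t u : ℝ) :
    (ENNReal.ofReal (Real.exp (ν * u))).toReal • Real.exp (-(c * Real.cosh u * t)) =
      Real.exp (ν * u - c * t * Real.cosh u) := by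
  rw [ENNReal.toReal_ofReal (Real.exp_pos _).le, smul_eq_mul, ← Real.exp_add]
  congr 1
  ring

/-- `coshMeasure ν c` is carried by `[c, ∞)` (`c > 0`): `c cosh u ≥ c`. [folklore] -/
theorem coshMeasure_Iio {ν c : ℝ} (hc : 0 < c) : coshMeasure ν c (Iio c) = 0 := by
  unfold coshMeasure
  rw [Measure.map_apply (measurable_const_mul_cosh c) measurableSet_Iio]
  have h0 : (fun u : ℝ => c * Real.cosh u) ⁻¹' Iio c = ∅ := by
    refine eq_empty_of_forall_notMem fun w hw => ?_
    have hw' : c * Real.cosh w < c := hw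
    exact (not_lt.2 (le_mul_of_one_le_right hc.le (Real.one_le_cosh w))) hw'
  rw [h0, measure_empty]

/-- `coshMeasure ν c` charges every interval `(α, β)` with `c ≤ α < β`: the preimage of `(α, β)`
under `u ↦ c cosh u` is a non-empty open set (it contains `arcosh ((α+β)/2c)`), and the density
`e^{νu}` is everywhere positive. [folklore] -/
theorem coshMeasure_Ioo_pos {ν c : ℝ} (hc : 0 < c) {α β : ℝ} (hα : c ≤ α) (hβ : α < β) :
    0 < coshMeasure ν c (Ioo α β) := by
  unfold coshMeasure
  rw [Measure.map_apply (measurable_const_mul_cosh c) measurableSet_Ioo, pos_iff_ne_zero, Ne,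
    withDensity_apply_eq_zero' (measurable_ofReal_exp_mul ν).aemeasurable]
  have hsupp : {w : ℝ | ENNReal.ofReal (Real.exp (ν * w)) ≠ 0} = univ := by
    refine eq_univ_of_forall fun w => ?_
    simp only [mem_setOf_eq, Ne, ENNReal.ofReal_eq_zero, not_le]
    exact Real.exp_pos _
  rw [hsupp, univ_inter]
  have hopen : IsOpen ((fun u : ℝ => c * Real.cosh u) ⁻¹' Ioo α β) :=
    isOpen_Ioo.preimage (continuous_const.mul Real.continuous_cosh)
  have hne : ((fun u : ℝ => c * Real.cosh u) ⁻¹' Ioo α β).Nonempty := by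
    have hv : 1 ≤ (α + β) / 2 / c := by rw [le_div_iff₀ hc]; linarith
    have hcv : c * ((α + β) / 2 / c) = (α + β) / 2 := by field_simp
    refine ⟨Real.arcosh ((α + β) / 2 / c), ?_⟩
    show c * Real.cosh (Real.arcosh ((α + β) / 2 / c)) ∈ Ioo α β
    rw [Real.cosh_arcosh hv, hcv]
    exact ⟨by linarith, by linarith⟩
  exact hopen.measure_ne_zero volume hne

/-- `l ↦ e^{-lt}` is `coshMeasure ν c`-integrable for `t > 0`, `c > 0`: pulled back to `u` the
integrand is `e^{νu - c t cosh u}` (`integrable_exp_mul_sub_mul_cosh`). [folklore] -/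
theorem integrable_exp_neg_mul_coshMeasure {ν c : ℝ} (hc : 0 < c) {t : ℝ} (ht : 0 < t) :
    Integrable (fun l : ℝ => Real.exp (-(l * t))) (coshMeasure ν c) := by
  unfold coshMeasure
  rw [integrable_map_measure (continuous_exp_neg_mul t).aestronglyMeasurable
      (measurable_const_mul_cosh c).aemeasurable,
    integrable_withDensity_iff_integrable_smul' (measurable_ofReal_exp_mul ν)
      (ae_of_all _ fun _ => ENNReal.ofReal_lt_top)]
  refine (integrable_exp_mul_sub_mul_cosh ν (mul_pos hc ht)).congr (ae_of_all _ fun w => ?_)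
  simp only [Function.comp_apply]
  exact (toReal_ofReal_exp_smul_exp_neg ν c t w).symm

/-- **The Laplace transform of `coshMeasure`**: `∫ e^{-lt} d(coshMeasure ν c) = ∫ e^{νu - ct cosh u} du`
(`integral_map` and `integral_withDensity_eq_integral_toReal_smul`; the identity needs neither
`c > 0` nor `t > 0`, which are kept for a uniform API). With `c = z` its even part is Watson's
`K_ν(zt) = ∫₀^∞ e^{-zt cosh u} cosh νu du`. [cite: Watson1944, §6.22 (5)] -/
theorem laplace_coshMeasure {ν c : ℝ} (_hc : 0 < c) {t : ℝ} (_ht : 0 < t) :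
    ∫ l, Real.exp (-(l * t)) ∂(coshMeasure ν c) = ∫ u : ℝ, Real.exp (ν * u - c * t * Real.cosh u) := by
  unfold coshMeasure
  rw [integral_map (measurable_const_mul_cosh c).aemeasurable
      (continuous_exp_neg_mul t).aestronglyMeasurable,
    integral_withDensity_eq_integral_toReal_smul (measurable_ofReal_exp_mul ν)
      (ae_of_all _ fun _ => ENNReal.ofReal_lt_top)]
  exact integral_congr_ae (ae_of_all _ fun w => toReal_ofReal_exp_smul_exp_neg ν c t w)

/-! ## The finite measure `e^{-l t₀} · coshMeasure ν c` -/

/-- The density `l ↦ e^{-l t₀}` (valued in `ℝ≥0∞`) is measurable. [folklore] -/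
theorem measurable_ofReal_exp_neg_mul (t₀ : ℝ) :
    Measurable fun l : ℝ => ENNReal.ofReal (Real.exp (-(l * t₀))) :=
  (continuous_exp_neg_mul t₀).measurable.ennreal_ofReal

/-- `e^{-l t₀} · coshMeasure ν c` is a finite measure for `c, t₀ > 0`: its mass is
`∫ e^{-l t₀} d(coshMeasure ν c) = ∫ e^{νu - c t₀ cosh u} du < ∞`. [folklore] -/
theorem isFiniteMeasure_withDensity_coshMeasure (ν : ℝ) {c t₀ : ℝ} (hc : 0 < c) (ht₀ : 0 < t₀) :
    IsFiniteMeasure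
      ((coshMeasure ν c).withDensity fun l => ENNReal.ofReal (Real.exp (-(l * t₀)))) :=
  isFiniteMeasure_withDensity_ofReal (integrable_exp_neg_mul_coshMeasure hc ht₀).hasFiniteIntegral

/-- `e^{-l t₀} · coshMeasure ν c` is carried by `[c, ∞)` (`c > 0`). [folklore] -/
theorem withDensity_coshMeasure_Iio (ν t₀ : ℝ) {c : ℝ} (hc : 0 < c) :
    ((coshMeasure ν c).withDensity fun l => ENNReal.ofReal (Real.exp (-(l * t₀)))) (Iio c) = 0 :=
  withDensity_absolutelyContinuous _ _ (coshMeasure_Iio hc)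

/-- `c` is in the support of `e^{-l t₀} · coshMeasure ν c` from the right: every `[c, c + ε)`,
`ε > 0`, has positive mass (`c > 0`). [folklore] -/
theorem withDensity_coshMeasure_Ico_pos (ν t₀ : ℝ) {c : ℝ} (hc : 0 < c) {ε : ℝ} (hε : 0 < ε) :
    0 < ((coshMeasure ν c).withDensity fun l => ENNReal.ofReal (Real.exp (-(l * t₀))))
      (Ico c (c + ε)) := by
  rw [pos_iff_ne_zero, Ne, withDensity_apply_eq_zero' (measurable_ofReal_exp_neg_mul t₀).aemeasurable]
  have hsupp : {x : ℝ | ENNReal.ofReal (Real.exp (-(x * t₀))) ≠ 0} = univ :=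
    eq_univ_of_forall fun x => by
      rw [mem_setOf_eq, Ne, ENNReal.ofReal_eq_zero, not_le]
      exact Real.exp_pos _
  rw [hsupp, univ_inter]
  exact fun h0 => (coshMeasure_Ioo_pos (ν := ν) hc le_rfl (by linarith : c < c + ε)).ne'
    (measure_mono_null Ioo_subset_Ico_self h0)

/-- The shifted Laplace transform of `e^{-l t₀} · coshMeasure ν c` is the Laplace transform of
`coshMeasure ν c`: `∫ e^{-l(t - t₀)} e^{-l t₀} d(coshMeasure) = ∫ e^{-lt} d(coshMeasure)`
(any real `t, t₀`). [folklore] -/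
theorem integral_exp_neg_mul_sub_withDensity_coshMeasure (ν c t₀ t : ℝ) :
    ∫ l, Real.exp (-(l * (t - t₀)))
        ∂((coshMeasure ν c).withDensity fun l => ENNReal.ofReal (Real.exp (-(l * t₀)))) =
      ∫ l, Real.exp (-(l * t)) ∂(coshMeasure ν c) := by
  rw [integral_withDensity_eq_integral_toReal_smul (measurable_ofReal_exp_neg_mul t₀)
    (ae_of_all _ fun _ => ENNReal.ofReal_lt_top)]
  refine integral_congr_ae (ae_of_all _ fun l => ?_)
  dsimp only
  rw [ENNReal.toReal_ofReal (Real.exp_pos _).le, smul_eq_mul, ← Real.exp_add]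
  congr 1
  ring

/-! ## `gammaMeasure` -/

/-- The Gamma density `l ↦ e^{-l t₀} l^{p-1}/Γ(p)` (valued in `ℝ≥0∞`) is measurable. [folklore] -/
theorem measurable_ofReal_gammaDensity (p t₀ : ℝ) :
    Measurable fun l : ℝ => ENNReal.ofReal (Real.exp (-(l * t₀)) * (l ^ (p - 1) / Real.Gamma p)) :=
  ((continuous_exp_neg_mul t₀).measurable.mul
    ((measurable_id.pow_const _).div_const _)).ennreal_ofReal

/-- The Gamma density `e^{-l t₀} l^{p-1}/Γ(p)` is positive on `(0, ∞)` for `p > 0`. [folklore] -/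
theorem gammaDensity_pos {p : ℝ} (hp : 0 < p) (t₀ : ℝ) {l : ℝ} (hl : 0 < l) :
    0 < Real.exp (-(l * t₀)) * (l ^ (p - 1) / Real.Gamma p) :=
  mul_pos (Real.exp_pos _) (div_pos (Real.rpow_pos_of_pos hl _) (Real.Gamma_pos_of_pos hp))

/-- `gammaMeasure p t₀` is finite (`p, t₀ > 0`): the Gamma integral converges
(`integrableOn_exp_neg_mul_mul_rpow_div_Gamma`). [folklore] -/
theorem isFiniteMeasure_gammaMeasure {p t₀ : ℝ} (hp : 0 < p) (ht₀ : 0 < t₀) :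
    IsFiniteMeasure (gammaMeasure p t₀) := by
  unfold gammaMeasure
  exact isFiniteMeasure_withDensity_ofReal
    (integrableOn_exp_neg_mul_mul_rpow_div_Gamma hp ht₀).hasFiniteIntegral

/-- `gammaMeasure` is carried by `[0, ∞)` (it is absolutely continuous with respect to Lebesgue
measure restricted to `(0, ∞)`). [folklore] -/
theorem gammaMeasure_Iio (p t₀ : ℝ) : gammaMeasure p t₀ (Iio 0) = 0 := by
  unfold gammaMeasure
  refine withDensity_absolutelyContinuous _ _ ?_
  rw [Measure.restrict_apply measurableSet_Iio]
  have h0 : Iio (0:ℝ) ∩ Ioi 0 = ∅ :=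
    eq_empty_of_forall_notMem fun x hx => lt_irrefl (0:ℝ) (hx.2.trans hx.1)
  rw [h0, measure_empty]

/-- `gammaMeasure` charges every `(α, β)`, `0 ≤ α < β` (`p > 0`; the density is positive on
`(0, ∞)`; `t₀ > 0` is not needed and kept for a uniform API). [folklore] -/
theorem gammaMeasure_Ioo_pos {p t₀ : ℝ} (hp : 0 < p) (_ht₀ : 0 < t₀) {α β : ℝ} (hα : 0 ≤ α)
    (hβ : α < β) : 0 < gammaMeasure p t₀ (Ioo α β) := by
  unfold gammaMeasure
  rw [pos_iff_ne_zero, Ne, withDensity_apply_eq_zero' (measurable_ofReal_gammaDensity p t₀).aemeasurable,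
    Measure.restrict_apply' measurableSet_Ioi]
  have hsub : Ioo α β ⊆
      ({x | ENNReal.ofReal (Real.exp (-(x * t₀)) * (x ^ (p - 1) / Real.Gamma p)) ≠ 0} ∩ Ioo α β) ∩
        Ioi 0 := by
    intro x hx
    have hx0 : 0 < x := hα.trans_lt hx.1
    refine ⟨⟨?_, hx⟩, hx0⟩
    rw [mem_setOf_eq, Ne, ENNReal.ofReal_eq_zero, not_le]
    exact gammaDensity_pos hp t₀ hx0
  intro h0
  have h1 := measure_mono_null hsub h0
  rw [Real.volume_Ioo, ENNReal.ofReal_eq_zero] at h1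
  linarith

/-- `∫ e^{-l(t - t₀)} d(gammaMeasure p t₀) = t^{-p}` for all `t > 0`, `p > 0` and real `t₀`:
`e^{-l t₀} e^{-l(t - t₀)} = e^{-lt}` and the Gamma integral `rpow_neg_eq_integral_exp_neg_mul`.
[cite: Feller1971, XIII.2 Example (b)] -/
theorem laplace_gammaMeasure_of_pos {p : ℝ} (t₀ : ℝ) (hp : 0 < p) {t : ℝ} (ht : 0 < t) :
    ∫ l, Real.exp (-(l * (t - t₀))) ∂(gammaMeasure p t₀) = t ^ (-p) := by
  unfold gammaMeasure
  rw [integral_withDensity_eq_integral_toReal_smul (measurable_ofReal_gammaDensity p t₀)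
      (ae_of_all _ fun _ => ENNReal.ofReal_lt_top),
    rpow_neg_eq_integral_exp_neg_mul hp ht]
  refine setIntegral_congr_fun measurableSet_Ioi fun l hl => ?_
  rw [ENNReal.toReal_ofReal (gammaDensity_pos hp t₀ hl).le, smul_eq_mul, mul_right_comm,
    ← Real.exp_add]
  congr 2
  ring

/-- **`∫ e^{-l(t - t₀)} d(gammaMeasure p t₀) = t^{-p}`** for `t > t₀ > 0`, `p > 0`
(the translation principle applied to `l^{p-1}/Γ(p) ↔ t^{-p}`).
[cite: Feller1971, XIII.2 Example (b)] -/
theorem laplace_gammaMeasure {p t₀ : ℝ} (hp : 0 < p) (ht₀ : 0 < t₀) {t : ℝ} (ht : t₀ < t) :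
    ∫ l, Real.exp (-(l * (t - t₀))) ∂(gammaMeasure p t₀) = t ^ (-p) :=
  laplace_gammaMeasure_of_pos t₀ hp (ht₀.trans ht)

/-! ## `besselLaplaceMeasure` -/

/-- `besselLaplaceMeasure ν p c t₀` is finite (`p, c, t₀ > 0`): both convolution factors are
(`isFiniteMeasure_withDensity_coshMeasure`, `isFiniteMeasure_gammaMeasure`). [folklore] -/
theorem isFiniteMeasure_besselLaplaceMeasure (ν : ℝ) {p c t₀ : ℝ} (hp : 0 < p) (hc : 0 < c)
    (ht₀ : 0 < t₀) : IsFiniteMeasure (besselLaplaceMeasure ν p c t₀) := by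
  haveI := isFiniteMeasure_withDensity_coshMeasure ν hc ht₀
  haveI := isFiniteMeasure_gammaMeasure hp ht₀
  unfold besselLaplaceMeasure
  infer_instance

/-- `besselLaplaceMeasure` is carried by `[c, ∞)`: lower supports add under convolution
(`conv_apply_Iio_eq_zero` with `[c, ∞) + [0, ∞)`; `p, t₀ > 0` are not needed and kept for a
uniform API). [folklore] -/
theorem besselLaplaceMeasure_Iio (ν : ℝ) {p c t₀ : ℝ} (_hp : 0 < p) (hc : 0 < c) (_ht₀ : 0 < t₀) :
    besselLaplaceMeasure ν p c t₀ (Iio c) = 0 := by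
  unfold besselLaplaceMeasure
  simpa only [add_zero] using
    conv_apply_Iio_eq_zero (withDensity_coshMeasure_Iio ν t₀ hc) (gammaMeasure_Iio p t₀)

/-- `besselLaplaceMeasure` charges every `(α, β)` with `c ≤ α < β` (`conv_apply_Ioo_pos`:
`gammaMeasure` charges every sub-interval of `[0, ∞)` and `c` is in the support of
`e^{-l t₀} · coshMeasure ν c` from the right). [folklore] -/
theorem besselLaplaceMeasure_Ioo_pos (ν : ℝ) {p c t₀ : ℝ} (hp : 0 < p) (hc : 0 < c) (ht₀ : 0 < t₀)
    {α β : ℝ} (hα : c ≤ α) (hβ : α < β) : 0 < besselLaplaceMeasure ν p c t₀ (Ioo α β) := by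
  unfold besselLaplaceMeasure
  exact conv_apply_Ioo_pos (fun α' β' hα' hβ' => gammaMeasure_Ioo_pos hp ht₀ hα' hβ')
    (fun ε hε => withDensity_coshMeasure_Ico_pos ν t₀ hc hε) hα hβ

/-- The Laplace identity for every `t > 0` (and every real shift `t₀`):
`t^{-p} ∫ e^{νu - c t cosh u} du = ∫ e^{-l(t - t₀)} d(besselLaplaceMeasure ν p c t₀)(l)`, by the
product theorem `integral_exp_neg_mul_conv`, `integral_exp_neg_mul_sub_withDensity_coshMeasure`,
`laplace_coshMeasure` and `laplace_gammaMeasure_of_pos`. [cite: Feller1971, XIII.2 (2.2)] -/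
theorem laplace_besselLaplaceMeasure_of_pos (ν t₀ : ℝ) {p c : ℝ} (hp : 0 < p) (hc : 0 < c)
    {t : ℝ} (ht : 0 < t) :
    (t ^ (-p) : ℝ) * ∫ u : ℝ, Real.exp (ν * u - c * t * Real.cosh u) =
      ∫ l, Real.exp (-(l * (t - t₀))) ∂(besselLaplaceMeasure ν p c t₀) := by
  unfold besselLaplaceMeasure
  rw [integral_exp_neg_mul_conv, integral_exp_neg_mul_sub_withDensity_coshMeasure,
    laplace_coshMeasure hc ht, laplace_gammaMeasure_of_pos t₀ hp ht, mul_comm]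

/-- **The Laplace identity**: for `t > t₀`,
`t^{-p} ∫ e^{νu - c t cosh u} du = ∫ e^{-l(t - t₀)} d(besselLaplaceMeasure ν p c t₀)(l)`
(product theorem `integral_exp_neg_mul_conv`, `laplace_coshMeasure`, `laplace_gammaMeasure`).
[cite: Feller1971, XIII.2 (2.2)] -/
theorem laplace_besselLaplaceMeasure (ν : ℝ) {p c t₀ : ℝ} (hp : 0 < p) (hc : 0 < c) (ht₀ : 0 < t₀)
    {t : ℝ} (ht : t₀ < t) :
    (t ^ (-p) : ℝ) * ∫ u : ℝ, Real.exp (ν * u - c * t * Real.cosh u) =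
      ∫ l, Real.exp (-(l * (t - t₀))) ∂(besselLaplaceMeasure ν p c t₀) :=
  laplace_besselLaplaceMeasure_of_pos ν t₀ hp hc (ht₀.trans ht)

/-- The total mass: `besselLaplaceMeasure ν p c t₀ (ℝ) = t₀^{-p} ∫ e^{νu - c t₀ cosh u} du`
(masses multiply under convolution; equivalently, the Laplace identity
`laplace_besselLaplaceMeasure_of_pos` at `t = t₀`). [folklore] -/
theorem besselLaplaceMeasure_real_univ (ν : ℝ) {p c t₀ : ℝ} (hp : 0 < p) (hc : 0 < c) (ht₀ : 0 < t₀) :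
    (besselLaplaceMeasure ν p c t₀).real univ =
      t₀ ^ (-p) * ∫ u : ℝ, Real.exp (ν * u - c * t₀ * Real.cosh u) := by
  rw [laplace_besselLaplaceMeasure_of_pos ν t₀ hp hc ht₀]
  simp only [sub_self, mul_zero, neg_zero, Real.exp_zero, integral_const, smul_eq_mul, mul_one]

/-! ## Decay in `c` -/

/-- Exponential decay of the cosh integral in `c`: for `0 < c₀ ≤ c` and `t > 0`,
`∫ e^{νu - c t cosh u} du ≤ e^{-(c - c₀) t} ∫ e^{νu - c₀ t cosh u} du`, since `cosh u ≥ 1` gives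
`c t cosh u ≥ c₀ t cosh u + (c - c₀) t` pointwise (`integral_mono`, both sides integrable by
`integrable_exp_mul_sub_mul_cosh`). [folklore] -/
theorem integral_exp_sub_mul_cosh_le_exp_mul (ν : ℝ) {c₀ c t : ℝ} (hc₀ : 0 < c₀) (hc : c₀ ≤ c)
    (ht : 0 < t) :
    ∫ u : ℝ, Real.exp (ν * u - c * t * Real.cosh u) ≤
      Real.exp (-((c - c₀) * t)) * ∫ u : ℝ, Real.exp (ν * u - c₀ * t * Real.cosh u) := by
  rw [← integral_const_mul]
  refine integral_mono (integrable_exp_mul_sub_mul_cosh ν (mul_pos (hc₀.trans_le hc) ht))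
    ((integrable_exp_mul_sub_mul_cosh ν (mul_pos hc₀ ht)).const_mul _) fun u => ?_
  dsimp only
  rw [← Real.exp_add]
  refine Real.exp_le_exp.2 ?_
  nlinarith [mul_nonneg (sub_nonneg.2 hc) ht.le, Real.one_le_cosh u]

end Literature.Analysis.SpecialFunctions
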